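import Literature.AlgebraicGeometry.HodgeTheory.AffineCoverDolbeaultLeray
import Literature.AlgebraicGeometry.HodgeTheory.ConjugateComplexPoints
import Literature.AlgebraicGeometry.HodgeTheory.HodgeModelAnalyticModel
import Literature.AlgebraicGeometry.Morphisms.DevissageHeart
import Literature.Geometry.Kaehler.HolomorphicFunctionsDolbeault
import Literature.Geometry.Kaehler.PluriharmonicConjugate
import HarnessLib

/-!
# GAGA on `H¹(𝒪)`, I: algebraic Čech cochains of `𝒪_X` realised as holomorphic Čech cochains

J.-P. Serre, *Géométrie algébrique et géométrie analytique*, Ann. Inst. Fourier 6 (1956), n° 12 Théorème 1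
(`H^q(X, 𝓕) ⥲ H^q(X^h, 𝓕^h)` for coherent algebraic `𝓕` on projective `X`). This file and its sequel
`GAGACechH1Comparison` prove the INJECTIVITY half for `𝓕 = 𝒪_X`, `q = 1`, at the level of a fixed finite affine
open cover `𝔘 = (U_i)` of a smooth projective `X/ℂ` with an analytic model `A` (`X^an = A.carrier`,
`ψ = A.toComplexPoints : A.carrier → X(ℂ)`): the comparison map
`Ȟ¹(𝔘, 𝒪_X) → Ȟ¹(𝔘^an, 𝒪^an)`, `(f_ij) ↦ (z ↦ f_ij(ψ z))`, from the algebraic Čech cohomology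
(`Morphisms.CechH1`) to the Čech cohomology of holomorphic functions (`0`-forms, `Kaehler.CechHolForms … 0`)
of the analytic cover `𝔘^an = (ψ⁻¹ U_i(ℂ))` is injective.

Contents of this file (the cochain level):

* `exists_holFormsOn_zero_apply_eq`, `mdifferentiableOn_coe_apply_zero_of_holFormsOn` — the dictionary
  «holomorphic function on an open `W` ↔ holomorphic `(0,0)`-form on `W`» in `MForm.ofFun` currency, over
  `Kaehler/HolomorphicFunctionsDolbeault` (Cauchy–Riemann at the points of an open set); cf. the same
  dictionary for subtype functions in `Geometry/ComplexAnalytic/HolomorphicCechH1` and `holOfFun` in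
  `Kaehler/HolomorphicLineBundleH1Finite` (neither is imported here);
* `coe_cechHolδ_apply_zero_eq_sum` — the value of the Čech differential of a cochain of holomorphic
  `0`-forms at a point (Bott–Tu (8.4));
* `holFormsOn_zero_ext`, `cechHolForms_zero_ext` — `0`-forms / cochains are determined by their values;
* `exists_cechHolForms_one_apply_eq`, `exists_cechHolForms_zero_apply_eq` — realisation of algebraic Čech
  `1`- and `0`-cochains as holomorphic cochains on `𝔘^an` (regular ⇒ holomorphic along `ψ`);
* `cechHolδ_one_eq_zero_of_apply_eq`, `cechHolδ_zero_eq_of_apply_eq` — the realisation commutes with the Čech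
  differentials (cocycles go to cocycles, `δ⁰b` goes to `δ⁰` of the realisation of `b`).

Everything here is proved; no definitions, no named facts. Consumer: `GAGACechH1Comparison`
(injectivity on `Ȟ¹` by Serre's Prop. 15 «holomorphe ⇒ régulière» in the form
`GAGARegularOfHolomorphicNumerator.exists_section_eval_eq_of_sub_eq_eval`), then the bound
`dim Ȟ¹(𝔘, 𝒪_{A₀}) ≤ dim A₀` for complex abelian varieties.

## References

* [SerreGAGA1956] J.-P. Serre, Géométrie algébrique et géométrie analytique, Ann. Inst. Fourier 6 (1956),
  §2 n° 6 (regular ⇒ holomorphic), n° 12 Théorème 1 (p. 19).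
* [VoisinHodgeI2002] C. Voisin, Hodge Theory and Complex Algebraic Geometry I (2002), §2.3.3 Lemma 2.34 (p. 57)
  (holomorphic ⟺ `∂̄`-closed for functions).
* [BottTu1982Forms] R. Bott, L. Tu, Differential Forms in Algebraic Topology (1982), §8 (8.4) (the Čech
  differential).
* [SGA1] A. Grothendieck, SGA 1, Exp. XII Prop. 2.1 (i) (complex points are dense in the constructible topology).
-/

noncomputable section

open scoped Manifold ContDiff Topology
open CategoryTheory AlgebraicGeometry Set TopologicalSpace
open Literature.AlgebraicGeometry.Motives (AlgPoints ComplexPoints SchemeOver IsSmoothProjective)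
open Literature.AlgebraicGeometry.Motives.AlgPoints (evalOrZero)
open Literature.Geometry.Kaehler Literature.Algebra.Homology Literature.AlgebraicGeometry.Morphisms
open Literature.NumberTheory.Transcendental

namespace Literature.AlgebraicGeometry.HodgeTheory

universe u

/-! ## Holomorphic `0`-forms on an open set versus holomorphic functions -/

section ZeroForms

variable {E : Type} [NormedAddCommGroup E] [NormedSpace ℂ E] [FiniteDimensional ℂ E]
  {M : Type} [TopologicalSpace M] [ChartedSpace E M] [T2Space M]
  [IsManifold 𝓘(ℂ, E) ω M] [IsManifold 𝓘(ℝ, E) ∞ M]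

/-- **A holomorphic function on an open `W` of a complex manifold is (the value function of) a holomorphic
`(0,0)`-form on `W`**: for `g` holomorphic on `W` there is `α ∈ Ω⁰(W)` (`holFormsOn E M hW 0`: real-`C^∞` at the
points of `W`, zero off `W`, `∂̄α = 0` on `W`) with `α_x = g x` for `x ∈ W` — namely the `0`-form of `g` cut off
outside `W` (`smoothAt_ofFun_of_mdifferentiableOn`, `dolbeaultBar_ofFun_eq_zero_of_mdifferentiableOn`; cf.
`Kaehler.holOfFun`). [cite: VoisinHodgeI2002, §2.3.3 Lemma 2.34 (p. 57)] -/
theorem exists_holFormsOn_zero_apply_eq {W : Set M} (hW : IsOpen W) {g : M → ℂ}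
    (hg : MDifferentiableOn 𝓘(ℂ, E) 𝓘(ℂ, ℂ) g W) :
    ∃ α : ↥(holFormsOn E M hW 0),
      ∀ x ∈ W, ((α : ↥(pqFormsOn E M W 0 0)) : MForm 𝓘(ℝ, E) M ℂ (0 + 0)) x 0 = g x := by
  classical
  -- `g` cut off outside `W`
  let f : M → ℂ := W.piecewise g 0
  have hfW : ∀ x ∈ W, f x = g x := fun x hx ↦ Set.piecewise_eq_of_mem _ _ _ hx
  have hf0 : ∀ x ∉ W, f x = 0 := fun x hx ↦ Set.piecewise_eq_of_notMem _ _ _ hx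
  have hf : MDifferentiableOn 𝓘(ℂ, E) 𝓘(ℂ, ℂ) f W := hg.congr hfW
  have hmem : MForm.ofFun 𝓘(ℝ, E) f ∈ pqFormsOn E M W 0 0 :=
    ⟨fun x hx ↦ smoothAt_ofFun_of_mdifferentiableOn hW hf hx, fun x hx ↦ by
      ext v
      rw [MForm.ofFun_apply, hf0 x hx]
      rfl, isOfType_zero_zero _⟩
  have hhol : (⟨_, hmem⟩ : ↥(pqFormsOn E M W 0 0)) ∈ holFormsOn E M hW 0 := by
    rw [mem_holFormsOn_iff]
    refine Subtype.ext (funext fun x ↦ ?_)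
    by_cases hx : x ∈ W
    · rw [coe_localDbar, MForm.restr_apply_of_mem _ hx]
      exact dolbeaultBar_ofFun_eq_zero_of_mdifferentiableOn hW hf hx
    · rw [coe_localDbar, MForm.restr_apply_of_notMem _ hx]
      rfl
  refine ⟨⟨_, hhol⟩, fun x hx ↦ ?_⟩
  change MForm.ofFun 𝓘(ℝ, E) f x 0 = g x
  rw [MForm.ofFun_apply, hfW x hx]

/-- **The value function of a holomorphic `(0,0)`-form on an open `W` is holomorphic on `W`** (it is real-`C^∞`
with `∂̄ = 0` at the points of `W`: Cauchy–Riemann, `mdifferentiableOn_of_dolbeaultBar_ofFun_eq_zero`; cf.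
`Kaehler.mdifferentiableOn_apply_zero_of_mem_holFormsOn`). [cite: VoisinHodgeI2002, §2.3.3 Lemma 2.34 (p. 57)] -/
theorem mdifferentiableOn_coe_apply_zero_of_holFormsOn {W : Set M} (hW : IsOpen W)
    (α : ↥(holFormsOn E M hW 0)) :
    MDifferentiableOn 𝓘(ℂ, E) 𝓘(ℂ, ℂ)
      (fun x ↦ ((α : ↥(pqFormsOn E M W 0 0)) : MForm 𝓘(ℝ, E) M ℂ (0 + 0)) x 0) W := by
  have hα := (mem_holFormsOn_iff 0 hW).1 α.2
  refine mdifferentiableOn_of_dolbeaultBar_ofFun_eq_zero (fun x hx ↦ ?_) (fun x hx ↦ ?_)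
  · rw [MForm.ofFun_apply_zero_eq]
    exact (α : ↥(pqFormsOn E M W 0 0)).2.1 x hx
  · rw [MForm.ofFun_apply_zero_eq, ← localDbar_apply_of_mem hW _ hx, hα]
    rfl

/-- Two holomorphic `0`-forms on an open `W` with the same values on `W` are equal (both vanish off `W`): the
`(0,0)`-forms on `W` are the functions on `W`. [cite: VoisinHodgeI2002, §2.3.1] -/
theorem holFormsOn_zero_ext {W : Set M} (hW : IsOpen W) {α β : ↥(holFormsOn E M hW 0)}
    (h : ∀ x ∈ W, ((α : ↥(pqFormsOn E M W 0 0)) : MForm 𝓘(ℝ, E) M ℂ (0 + 0)) x 0 =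
      ((β : ↥(pqFormsOn E M W 0 0)) : MForm 𝓘(ℝ, E) M ℂ (0 + 0)) x 0) : α = β := by
  refine Subtype.ext (Subtype.ext (funext fun x ↦ ?_))
  ext v
  have hv : v = 0 := funext fun i ↦ absurd i.2 (by omega)
  rw [hv]
  by_cases hx : x ∈ W
  · exact h x hx
  · rw [(α : ↥(pqFormsOn E M W 0 0)).2.2.1 x hx, (β : ↥(pqFormsOn E M W 0 0)).2.2.1 x hx]

variable {ι : Type} {V : ι → Set M} (hV : ∀ i, IsOpen (V i))

/-- Two Čech cochains of holomorphic `0`-forms with the same values on the finite intersections are equal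
(`(0,0)`-forms are functions). [cite: VoisinHodgeI2002, §2.3.1] -/
theorem cechHolForms_zero_ext {a : ℕ} {γ γ' : CechHolForms E M V hV 0 a}
    (h : ∀ (J : Fin (a + 1) → ι) (x : M), x ∈ cechSet V J →
      ((γ J : ↥(pqFormsOn E M (cechSet V J) 0 0)) : MForm 𝓘(ℝ, E) M ℂ (0 + 0)) x 0 =
        ((γ' J : ↥(pqFormsOn E M (cechSet V J) 0 0)) : MForm 𝓘(ℝ, E) M ℂ (0 + 0)) x 0) : γ = γ' :=
  funext fun J ↦ holFormsOn_zero_ext (isOpen_cechSet hV J) (h J)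

/-- **The value of the Čech differential of a cochain of holomorphic `0`-forms at a point of the intersection**,
`(δγ)_J(x) = ∑_j (-1)^j γ_{J ∘ δ_j}(x)` (restriction of `0`-forms does not change values at the points of the
smaller set). [cite: BottTu1982Forms, §8 (8.4)] -/
theorem coe_cechHolδ_apply_zero_eq_sum {a : ℕ} (γ : CechHolForms E M V hV 0 a) (J : Fin (a + 2) → ι) {x : M}
    (hx : x ∈ cechSet V J) :
    (((cechHolδ E M hV 0 a γ J : ↥(holFormsOn E M (isOpen_cechSet hV J) 0)) :
        ↥(pqFormsOn E M (cechSet V J) 0 0)) : MForm 𝓘(ℝ, E) M ℂ (0 + 0)) x 0 =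
      ∑ j : Fin (a + 2), (-1 : ℂ) ^ (j : ℕ) *
        ((γ (J ∘ Fin.succAbove j) : ↥(pqFormsOn E M (cechSet V (J ∘ Fin.succAbove j)) 0 0)) :
          MForm 𝓘(ℝ, E) M ℂ (0 + 0)) x 0 := by
  have h : (((cechHolδ E M hV 0 a γ J : ↥(holFormsOn E M (isOpen_cechSet hV J) 0)) :
      ↥(pqFormsOn E M (cechSet V J) 0 0)) : MForm 𝓘(ℝ, E) M ℂ (0 + 0)) =
      ∑ j : Fin (a + 2), (-1 : ℂ) ^ (j : ℕ) •
        (((γ (J ∘ Fin.succAbove j) : ↥(pqFormsOn E M (cechSet V (J ∘ Fin.succAbove j)) 0 0)) :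
          MForm 𝓘(ℝ, E) M ℂ (0 + 0)).restr (cechSet V J)) := by
    change ((cechHolIncl E M hV 0 (a + 1) (cechHolδ E M hV 0 a γ) J : ↥(pqFormsOn E M (cechSet V J) 0 0)) :
      MForm 𝓘(ℝ, E) M ℂ (0 + 0)) = _
    rw [cechHolIncl_cechHolδ, coe_cechδPQ_apply]
    rfl
  rw [h, Finset.sum_apply, ContinuousAlternatingMap.sum_apply]
  refine Finset.sum_congr rfl fun j _ ↦ ?_
  rw [Pi.smul_apply, ContinuousAlternatingMap.smul_apply, MForm.restr_apply_of_mem _ hx, smul_eq_mul]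

/-- The degree-`0 → 1` case: `(δγ)_J(x) = γ_{J 1}(x) - γ_{J 0}(x)` on a double intersection.
[cite: BottTu1982Forms, §8 (8.4)] -/
theorem coe_cechHolδ_zero_apply_of_mem (γ : CechHolForms E M V hV 0 0) (J : Fin 2 → ι) {x : M}
    (hx : x ∈ cechSet V J) :
    (((cechHolδ E M hV 0 0 γ J : ↥(holFormsOn E M (isOpen_cechSet hV J) 0)) :
        ↥(pqFormsOn E M (cechSet V J) 0 0)) : MForm 𝓘(ℝ, E) M ℂ (0 + 0)) x 0 =
      ((γ (J ∘ Fin.succAbove 0) : ↥(pqFormsOn E M (cechSet V (J ∘ Fin.succAbove 0)) 0 0)) :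
          MForm 𝓘(ℝ, E) M ℂ (0 + 0)) x 0 -
        ((γ (J ∘ Fin.succAbove 1) : ↥(pqFormsOn E M (cechSet V (J ∘ Fin.succAbove 1)) 0 0)) :
          MForm 𝓘(ℝ, E) M ℂ (0 + 0)) x 0 := by
  rw [coe_cechHolδ_apply_zero_eq_sum hV γ J hx, Fin.sum_univ_two]
  simp only [Fin.val_zero, Fin.val_one, pow_zero, pow_one, one_mul, neg_mul]
  ring

omit [TopologicalSpace M] in
/-- Membership in the intersection `U_J = U_{J 0} ∩ U_{J 1}` attached to a `2`-tuple `J`.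
[cite: BottTu1982Forms, §8 (8.1)] -/
theorem mem_cechSet_fin_two_iff' {J : Fin 2 → ι} {x : M} : x ∈ cechSet V J ↔ x ∈ V (J 0) ∧ x ∈ V (J 1) := by
  simp only [mem_cechSet_iff, Fin.forall_fin_two]

omit [TopologicalSpace M] in
/-- Membership in the intersection `U_{ij} = U_i ∩ U_j` attached to a pair. [cite: BottTu1982Forms, §8 (8.1)] -/
theorem mem_cechSet_pair_iff' {i j : ι} {x : M} : x ∈ cechSet V ![i, j] ↔ x ∈ V i ∧ x ∈ V j := by
  simp only [mem_cechSet_iff, Fin.forall_fin_two, Matrix.cons_val_zero, Matrix.cons_val_one]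

end ZeroForms

/-! ## Values of regular functions at complex points -/

section Values

variable {X : SchemeOver ℂ}

/-- Evaluation of regular functions at a complex point is additive (total form). [folklore] -/
private theorem evalOrZero_add' {O : X.left.Opens} (s t : Γ(X.left, O)) (P : ComplexPoints X) :
    evalOrZero O (s + t) P = evalOrZero O s P + evalOrZero O t P := by
  by_cases hP : P.pt ∈ O
  · simp only [AlgPoints.evalOrZero_of_mem _ hP, AlgPoints.eval, map_add]
  · simp only [AlgPoints.evalOrZero_of_not_mem _ hP, add_zero]

/-- Evaluation of regular functions at a complex point respects subtraction (total form). [folklore] -/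
private theorem evalOrZero_sub' {O : X.left.Opens} (s t : Γ(X.left, O)) (P : ComplexPoints X) :
    evalOrZero O (s - t) P = evalOrZero O s P - evalOrZero O t P := by
  by_cases hP : P.pt ∈ O
  · simp only [AlgPoints.evalOrZero_of_mem _ hP, AlgPoints.eval, map_sub]
  · simp only [AlgPoints.evalOrZero_of_not_mem _ hP, sub_zero]

/-- The zero function evaluates to zero (total form). [folklore] -/
private theorem evalOrZero_zero' {O : X.left.Opens} (P : ComplexPoints X) : evalOrZero O (0 : Γ(X.left, O)) P = 0 := by
  by_cases hP : P.pt ∈ O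
  · simp only [AlgPoints.evalOrZero_of_mem _ hP, AlgPoints.eval, map_zero]
  · simp only [AlgPoints.evalOrZero_of_not_mem _ hP]


end Values

/-! ## The comparison on cochains: existence, the cocycle and coboundary identities -/

section Cochains

variable {n : ℕ} {X : SchemeOver ℂ}
  {E : Type} [NormedAddCommGroup E] [NormedSpace ℂ E] [FiniteDimensional ℂ E]
  (A : AnalyticModel E n X) {ι : Type} (U : ι → X.left.Opens)

/-- Points of `ψ⁻¹U_J(ℂ)` (`J` a pair) map into `U_{J 0} ∩ U_{J 1}`. [folklore] -/
private theorem pt_mem_inf_of_mem_cechSet_two (J : Fin 2 → ι) {x : A.carrier} (hx : x ∈ cechSet (A.coverSet U) J) :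
    (A.toComplexPoints x).pt ∈ U (J 0) ⊓ U (J 1) := by
  have hx' := (mem_cechSet_fin_two_iff' (V := A.coverSet U)).1 hx
  exact ⟨(A.mem_openSet_iff _ x).1 hx'.1, (A.mem_openSet_iff _ x).1 hx'.2⟩

/-- **The algebraic Čech `1`-cochains realised as holomorphic `0`-forms on the analytic double intersections**:
for `c ∈ Č¹(𝔘, 𝒪_X)` there is a (unique) cochain of holomorphic `0`-forms on `𝔘^an` with values `z ↦ c_{J0 J1}(ψ z)`
on `ψ⁻¹U_J(ℂ)` (regular functions are holomorphic along the analytification, [SerreGAGA1956, §2 n°6]).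
[cite: SerreGAGA1956, §2 n°6] -/
theorem exists_cechHolForms_one_apply_eq (c : CechC1 X.hom U) :
    ∃ γ : CechHolForms E A.carrier (A.coverSet U) (A.isOpen_coverSet U) 0 1,
      ∀ (J : Fin 2 → ι) (x : A.carrier), x ∈ cechSet (A.coverSet U) J →
        ((γ J : ↥(pqFormsOn E A.carrier (cechSet (A.coverSet U) J) 0 0)) : MForm 𝓘(ℝ, E) A.carrier ℂ (0 + 0)) x 0 =
          evalOrZero (U (J 0) ⊓ U (J 1)) (Sections.equiv X.hom _ (c (J 0) (J 1))) (A.toComplexPoints x) := by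
  have key : ∀ J : Fin 2 → ι, ∃ α : ↥(holFormsOn E A.carrier (isOpen_cechSet (A.isOpen_coverSet U) J) 0),
      ∀ x ∈ cechSet (A.coverSet U) J,
        ((α : ↥(pqFormsOn E A.carrier (cechSet (A.coverSet U) J) 0 0)) : MForm 𝓘(ℝ, E) A.carrier ℂ (0 + 0)) x 0 =
          evalOrZero (U (J 0) ⊓ U (J 1)) (Sections.equiv X.hom _ (c (J 0) (J 1))) (A.toComplexPoints x) :=
    fun J ↦ exists_holFormsOn_zero_apply_eq (isOpen_cechSet (A.isOpen_coverSet U) J)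
      ((IsAnalytification.mdifferentiableOn_evalOrZero_opens_holds A.isAnalytification _ _).mono
        fun x hx ↦ pt_mem_inf_of_mem_cechSet_two A U J hx)
  choose γ hγ using key
  exact ⟨γ, hγ⟩

/-- The same in Čech degree `0`: values `z ↦ b_{J 0}(ψ z)` on `ψ⁻¹U_{J 0}(ℂ)`. [cite: SerreGAGA1956, §2 n°6] -/
theorem exists_cechHolForms_zero_apply_eq (b : CechC0 X.hom U) :
    ∃ γ : CechHolForms E A.carrier (A.coverSet U) (A.isOpen_coverSet U) 0 0,
      ∀ (J : Fin 1 → ι) (x : A.carrier), x ∈ cechSet (A.coverSet U) J →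
        ((γ J : ↥(pqFormsOn E A.carrier (cechSet (A.coverSet U) J) 0 0)) : MForm 𝓘(ℝ, E) A.carrier ℂ (0 + 0)) x 0 =
          evalOrZero (U (J 0)) (Sections.equiv X.hom _ (b (J 0))) (A.toComplexPoints x) := by
  have key : ∀ J : Fin 1 → ι, ∃ α : ↥(holFormsOn E A.carrier (isOpen_cechSet (A.isOpen_coverSet U) J) 0),
      ∀ x ∈ cechSet (A.coverSet U) J,
        ((α : ↥(pqFormsOn E A.carrier (cechSet (A.coverSet U) J) 0 0)) : MForm 𝓘(ℝ, E) A.carrier ℂ (0 + 0)) x 0 =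
          evalOrZero (U (J 0)) (Sections.equiv X.hom _ (b (J 0))) (A.toComplexPoints x) :=
    fun J ↦ exists_holFormsOn_zero_apply_eq (isOpen_cechSet (A.isOpen_coverSet U) J)
      ((IsAnalytification.mdifferentiableOn_evalOrZero_opens_holds A.isAnalytification _ _).mono
        fun x hx ↦ (A.mem_openSet_iff _ x).1 (by rwa [cechSet_fin_one] at hx))
  choose γ hγ using key
  exact ⟨γ, hγ⟩

/-- **The realisation of an algebraic `1`-COCYCLE is a holomorphic `1`-cocycle** (the cocycle identity
`c_{jk} - c_{ik} + c_{ij} = 0` evaluates to the holomorphic one at every point of `ψ⁻¹U_{ijk}(ℂ)`).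
[cite: BottTu1982Forms, §8 (8.4)] -/
theorem cechHolδ_one_eq_zero_of_apply_eq (z : ↥(cechZ1 X.hom U))
    (γ : CechHolForms E A.carrier (A.coverSet U) (A.isOpen_coverSet U) 0 1)
    (hγ : ∀ (J : Fin 2 → ι) (x : A.carrier), x ∈ cechSet (A.coverSet U) J →
      ((γ J : ↥(pqFormsOn E A.carrier (cechSet (A.coverSet U) J) 0 0)) : MForm 𝓘(ℝ, E) A.carrier ℂ (0 + 0)) x 0 =
        evalOrZero (U (J 0) ⊓ U (J 1)) (Sections.equiv X.hom _ ((z : CechC1 X.hom U) (J 0) (J 1)))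
          (A.toComplexPoints x)) :
    cechHolδ E A.carrier (A.isOpen_coverSet U) 0 1 γ = 0 := by
  have hz := (mem_cechZ1_iff X.hom U (z : CechC1 X.hom U)).1 z.2
  refine cechHolForms_zero_ext (A.isOpen_coverSet U) fun J x hx ↦ ?_
  rw [coe_cechHolδ_apply_zero_eq_sum (A.isOpen_coverSet U) γ J hx, Fin.sum_univ_three,
    hγ _ x (cechSet_subset_comp _ J _ hx), hγ _ x (cechSet_subset_comp _ J _ hx),
    hγ _ x (cechSet_subset_comp _ J _ hx)]
  rw [show ((((0 : CechHolForms E A.carrier (A.coverSet U) (A.isOpen_coverSet U) 0 2) J :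
      ↥(holFormsOn E A.carrier (isOpen_cechSet (A.isOpen_coverSet U) J) 0)) :
      ↥(pqFormsOn E A.carrier (cechSet (A.coverSet U) J) 0 0)) : MForm 𝓘(ℝ, E) A.carrier ℂ (0 + 0)) x 0 = 0 from rfl]
  -- the algebraic cocycle identity at `ψ x ∈ U_{J0} ∩ U_{J1} ∩ U_{J2}`
  have hxJ : ∀ k : Fin 3, (A.toComplexPoints x).pt ∈ U (J k) := fun k ↦
    (A.mem_openSet_iff _ x).1 ((mem_cechSet_iff.1 hx) k)
  have hxijk : (A.toComplexPoints x).pt ∈ U (J 0) ⊓ U (J 1) ⊓ U (J 2) := ⟨⟨hxJ 0, hxJ 1⟩, hxJ 2⟩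
  have h3 := congrFun (congrFun (congrFun hz (J 0)) (J 1)) (J 2)
  rw [cechD1_apply, Pi.zero_apply, Pi.zero_apply, Pi.zero_apply] at h3
  have h4 := congrArg (fun s : Sections X.hom (U (J 0) ⊓ U (J 1) ⊓ U (J 2)) ↦
    evalOrZero _ (Sections.equiv X.hom _ s) (A.toComplexPoints x)) h3
  simp only [map_add, map_sub, map_zero, evalOrZero_add', evalOrZero_sub', evalOrZero_zero'] at h4
  have hres : ∀ {O O' : X.left.Opens} (hle : O' ≤ O) (s : Sections X.hom O), (A.toComplexPoints x).pt ∈ O' →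
      evalOrZero O' (Sections.equiv X.hom O' (Sections.res X.hom hle s)) (A.toComplexPoints x) =
        evalOrZero O (Sections.equiv X.hom O s) (A.toComplexPoints x) :=
    fun hle s hx' ↦ AlgPoints.evalOrZero_map_homOfLE hle _ hx'
  rw [hres _ _ hxijk, hres _ _ hxijk, hres _ _ hxijk] at h4
  change (-1 : ℂ) ^ ((0 : Fin 3) : ℕ) *
      evalOrZero (U (J 1) ⊓ U (J 2)) (Sections.equiv X.hom _ ((z : CechC1 X.hom U) (J 1) (J 2))) (A.toComplexPoints x) +
    (-1 : ℂ) ^ ((1 : Fin 3) : ℕ) *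
      evalOrZero (U (J 0) ⊓ U (J 2)) (Sections.equiv X.hom _ ((z : CechC1 X.hom U) (J 0) (J 2))) (A.toComplexPoints x) +
    (-1 : ℂ) ^ ((2 : Fin 3) : ℕ) *
      evalOrZero (U (J 0) ⊓ U (J 1)) (Sections.equiv X.hom _ ((z : CechC1 X.hom U) (J 0) (J 1))) (A.toComplexPoints x) = 0
  simp only [Fin.val_zero, Fin.val_one, Fin.val_two, pow_zero, pow_one, one_mul]
  linear_combination h4

/-- **The realisation of an algebraic `1`-COBOUNDARY `δ⁰b` is the holomorphic coboundary of the realisation of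
`b`.** [cite: BottTu1982Forms, §8 (8.4)] -/
theorem cechHolδ_zero_eq_of_apply_eq (b : CechC0 X.hom U)
    (γ₀ : CechHolForms E A.carrier (A.coverSet U) (A.isOpen_coverSet U) 0 0)
    (hγ₀ : ∀ (J : Fin 1 → ι) (x : A.carrier), x ∈ cechSet (A.coverSet U) J →
      ((γ₀ J : ↥(pqFormsOn E A.carrier (cechSet (A.coverSet U) J) 0 0)) : MForm 𝓘(ℝ, E) A.carrier ℂ (0 + 0)) x 0 =
        evalOrZero (U (J 0)) (Sections.equiv X.hom _ (b (J 0))) (A.toComplexPoints x))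
    (γ : CechHolForms E A.carrier (A.coverSet U) (A.isOpen_coverSet U) 0 1)
    (hγ : ∀ (J : Fin 2 → ι) (x : A.carrier), x ∈ cechSet (A.coverSet U) J →
      ((γ J : ↥(pqFormsOn E A.carrier (cechSet (A.coverSet U) J) 0 0)) : MForm 𝓘(ℝ, E) A.carrier ℂ (0 + 0)) x 0 =
        evalOrZero (U (J 0) ⊓ U (J 1)) (Sections.equiv X.hom _ (cechD0 X.hom U b (J 0) (J 1)))
          (A.toComplexPoints x)) :
    cechHolδ E A.carrier (A.isOpen_coverSet U) 0 0 γ₀ = γ := by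
  refine cechHolForms_zero_ext (A.isOpen_coverSet U) fun J x hx ↦ ?_
  rw [coe_cechHolδ_zero_apply_of_mem (A.isOpen_coverSet U) γ₀ J hx,
    hγ₀ _ x (cechSet_subset_comp _ J _ hx), hγ₀ _ x (cechSet_subset_comp _ J _ hx), hγ J x hx]
  have hxJ := pt_mem_inf_of_mem_cechSet_two A U J hx
  change evalOrZero (U (J 1)) (Sections.equiv X.hom _ (b (J 1))) (A.toComplexPoints x) -
      evalOrZero (U (J 0)) (Sections.equiv X.hom _ (b (J 0))) (A.toComplexPoints x) = _
  rw [cechD0_apply, map_sub, evalOrZero_sub']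
  change _ = evalOrZero _ (X.left.presheaf.map (homOfLE inf_le_right).op (Sections.equiv X.hom _ (b (J 1)))) _ -
    evalOrZero _ (X.left.presheaf.map (homOfLE inf_le_left).op (Sections.equiv X.hom _ (b (J 0)))) _
  rw [AlgPoints.evalOrZero_map_homOfLE _ _ hxJ, AlgPoints.evalOrZero_map_homOfLE _ _ hxJ]

end Cochains

end Literature.AlgebraicGeometry.HodgeTheory
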